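import Mathlib
import HarnessLib
import Summits.HubbardSuperconductivity.HubbardSuperconductivity.Theorems.KLProgrammeKLRegimeEngineScaleZeroTwoLegBareFrame
import Summits.HubbardSuperconductivity.HubbardSuperconductivity.Theorems.KLProgrammeKLRegimeScaleZeroDetBoundFreeBand

/-!
# Route `KLProgramme`, ENGINE child (stmt-…-20437), stub (C) at `n = 0` (located item #22 «(C)-SCALE0-NATURAL», piece (a3)):
# the ORDER-≥3 TAIL of the scale-`0` two-leg kernel at the bare frame — the `n₀ = 3` twin of p1b's `twoLeg_offDiag_moment_pow_sum_frameZero_le`,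
# with a SCALED decay weight `(1 + λ·diam)ᵏ` and the bare-frame determinant constant `δ₀ = √46`

Cell gate-hubbard-kl, seat p1 (g18).  The n = 0 reading `ν₀(0)` of stub (C) is read off the two-leg kernel of the UV one-shot
`W₀ = effAction (S_{4M}ᵀ C⁰_{>e₀} S_{4M}) V_{4M}` (bare frame `K₀ = 0`: no counterterm).  Its second-order perturbation theory (memo
SCALE0-REMAINDER-BUDGET / C-SCALE0-NATURAL §5(a), KL STATUS (R109)/(R123)) splits `kernel₂ W₀ = kernel₂(e^{Δ}V)` [on-site] `− kernel₂(½(e^{Δ}V² − (e^{Δ}V)²))`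
[sunset + chain, the (a2)/π1 piece] `+ kernel₂(T₃)`, `T₃ := W₀ − e^{Δ}V + ½(e^{Δ}V² − (e^{Δ}V)²)` — the ORDER-≥3 TAIL.  This file bounds the tail's off-site
`k`-th spatial moments, for every `k`, by the Literature truncation lemma at `n₀ = 3`
(`GrassmannWeightedEffectiveActionTruncationDB.sum_wt_norm_kernel_effAction_sub_secondOrder_le_of_gramBounded`) with two refinements of the bookkeeping:
(i) the tree weight is the SCALED polynomial weight `(1 + λ·diam)ᵏ`, `0 < λ ≤ 1` (still a tree weight: `isTreeWeight_polyDiamWeight` at slope `λ`), against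
which the off-site moment weight costs `(2/λ)ᵏ` (`offDiagMomentWeight_pow_le_scaledPolyWt`) — so the weighted covariance size entering `θ` is
`a_λ = Σ_j C(k,j)λʲa_j`, which a consumer makes `≤ 2ᵏa₀` by `λ := min_j (a₀/a_j)^{1/j}` instead of paying the full `k`-th moment `a_k` on every line;
(ii) the Gram constant is the bare-frame `δ₀ = √(2·(7+16)) = √46` of `…ScaleZeroDetBoundFreeBand` (window `klWindowC`, `klEngL₃ β U ≤ L`), not `√3213478`.

* §1 `offDiagMomentWeight_pow_le_scaledPolyWt`, `isTreeWeight_scaledPolyWt`, `sum_norm_kernel_hubbardGridInteraction_mul_scaledPolyWt_le` (slope-`λ` bookkeeping);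
* §2 `twoLeg_wsum_tail3_le` — ANY Gram-bounded covariance, ANY tree weight: `Σ_{Y : Y 0 = w} ω(Y)‖kernel₂ T₃ (Y)‖ ≤ c·ρ⁻²·e‖V‖_{h,wt}·θ²/(1−θ)` for `ω ≤ c·wt`;
* §3 `twoLeg_offDiag_moment_pow_sum_tail3_le` — the grid-point form with the off-site `k`-th moment weight (`c = (2/λ)ᵏ`);
* §4 **`twoLeg_offDiag_moment_pow_sum_tail3_frameZero_le`** — CLOSED FORM at the bare frame: with `a` the normalised `(1+λ·diam)ᵏ`-weighted row/column
  size of `SᵀC⁰_{>e₀}S` (`Σ_Y‖C X Y‖(1+λd)ᵏ ≤ a·4M/β`) and `16e⁹·46·a·|U| ≤ 1/2`: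
  `Σ_{p₁}[x⃗₁ ≠ x⃗₀](1+|Δx̃₀|+|Δx̃₁|)ᵏ‖kernel₂ T₃ ((p₀,σ,+),(p₁,σ,−))‖ ≤ (2/λ)ᵏ·2¹³·e²⁷·46³·a²·|U|³·β/(4M)` — PURE `|U|³`, `M`-, `L`-, `β`-uniform.
  (In reading units `×2·4M/β`: `2^{k+14}λ^{-k}e²⁷46³a²|U|³ ≈ 4·10²¹·(2/λ)ᵏa²·|U|³`; under (C)'s door `|U| ≤ 7.9·10⁻³⁸` this books into the un-primed column for
  `k ≤ 2` at natural `a` — memo v3 CORRECTION box / k3c5-p1 KL STATUS l.4757.)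
The weighted sizes `a` are HYPOTHESES (k3c5-p1's π3 / [B1]); nothing here is a definition; everything PROVED.
References: BGM 2006 (2.13)–(2.14), (2.77)–(2.80), §3 [cite: BenfattoGiulianiMastropietro2006]; Pedra–Salmhofer 2008 Thm 2.4 [cite: PedraSalmhofer2008].
-/

noncomputable section

namespace Summit.HubbardSuperconductivity.HubbardSuperconductivity.Theorems.EngineV8

set_option linter.dupNamespace false -- summit = problem name (single-conjunct summit), D-0017

open Real Finset Literature.MathematicalPhysics.QuantumLattice Literature.Probability.LatticeModels
open Literature.Probability.LatticeModels.BattleFederbush GrassmannAlgebra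
open Summit.HubbardSuperconductivity.HubbardSuperconductivity.Theorems.KLRegimeSplit
open Summit.HubbardSuperconductivity.HubbardSuperconductivity.Theorems.DispersionFlow

variable {L N : ℕ} [NeZero L] [NeZero N]

/-! ## §1 The scaled polynomial weight `(1 + λ·diam)ᵏ` -/

/-- **The off-diagonal `k`-th moment weight against the SCALED polynomial weight**: for `0 < λ ≤ 1`,
`[x⃗₁ ≠ x⃗₀]·(1 + |Δx̃₀| + |Δx̃₁|)ᵏ ≤ (2/λ)ᵏ·(1 + λ·diam)ᵏ` (`β′ ≥ 0`). -/
theorem offDiagMomentWeight_pow_le_scaledPolyWt {β' : ℝ} (hβ' : 0 ≤ β') {lam : ℝ} (hlam0 : 0 < lam) (hlam1 : lam ≤ 1) (k : ℕ)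
    (Y : Fin 2 → GridLeg (GridPoint L N)) :
    (if (Y 1).1.1.2 - (Y 0).1.1.2 = 0 then (0 : ℝ) else
      (1 + ((((Y 1).1.1.2 - (Y 0).1.1.2) 0).valMinAbs.natAbs : ℝ) + ((((Y 1).1.1.2 - (Y 0).1.1.2) 1).valMinAbs.natAbs : ℝ)) ^ k) ≤
      (2 / lam) ^ k * diamWeight (fun s => (1 + lam * s) ^ k) (gridLabelDist L N β') ((univ.image Y).image gridLegPos) := by
  have h := offDiagMomentWeight_pow_le_two_pow_mul_polyWt (L := L) (N := N) hβ' k Y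
  refine h.trans ?_
  set D := labelDiam (gridLabelDist L N β') ((univ.image Y).image gridLegPos) with hD
  have hD0 : 0 ≤ D := labelDiam_nonneg _ _
  simp only [diamWeight, one_mul]
  rw [← hD]
  -- `(1 + D) ≤ (1 + λD)/λ`
  have h1 : 1 + D ≤ (1 + lam * D) / lam := by
    rw [le_div_iff₀ hlam0]
    nlinarith
  have h2 : (1 + D) ^ k ≤ ((1 + lam * D) / lam) ^ k := pow_le_pow_left₀ (by positivity) h1 k
  calc (2 : ℝ) ^ k * (1 + D) ^ k ≤ 2 ^ k * ((1 + lam * D) / lam) ^ k := mul_le_mul_of_nonneg_left h2 (by positivity)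
    _ = (2 / lam) ^ k * (1 + lam * D) ^ k := by rw [div_pow, div_pow]; ring

/-- `wt(S) = (1 + λ·diam (S.image gridLegPos))ᵏ` is a tree weight (`β′ ≥ 0`, `λ ≥ 0`). -/
theorem isTreeWeight_scaledPolyWt {β' : ℝ} (hβ' : 0 ≤ β') {lam : ℝ} (hlam : 0 ≤ lam) (k : ℕ) :
    IsTreeWeight (fun S : Finset (GridLeg (GridPoint L N)) =>
      diamWeight (fun s => (1 + lam * s) ^ k) (gridLabelDist L N β') (S.image gridLegPos)) :=
  (isTreeWeight_polyDiamWeight (isLabelDist_gridLabelDist L N hβ') hlam k).comap gridLegPos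

/-- **The scaled weight of the position set of a quartic kernel entry is `1`** (all four legs at one grid point). -/
theorem scaledPolyWt_image_eq_one_of_kernel_hubbardGridInteraction_ne_zero (β U β' lam : ℝ) (k : ℕ) (X : Fin 4 → GridLeg (GridPoint L N))
    (hX : kernel ℂ (hubbardGridInteraction L N β U) 4 X ≠ 0) :
    diamWeight (fun s => (1 + lam * s) ^ k) (gridLabelDist L N β') ((univ.image X).image gridLegPos) = 1 := by
  have h := gridLabelWt_image_eq_one_of_kernel_hubbardGridInteraction_ne_zero β β' U X hX
  rw [gridLabelWt_apply] at h
  have hd : labelDiam (gridLabelDist L N β') ((univ.image X).image gridLegPos) = 0 := by linarith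
  rw [diamWeight, hd]; norm_num

/-- **The scaled-weight pinned profile of the bare grid vertex `V_N`**: `≤ |U||β|/N` in degree `4`, `0` otherwise — in p3's profile shape at `K = 0`. -/
theorem sum_norm_kernel_hubbardGridInteraction_mul_scaledPolyWt_le (β U : ℝ) {β' : ℝ} (lam : ℝ) (k : ℕ) (m' : ℕ) (j : Fin (2 * m'))
    (w : GridLeg (GridPoint L N)) :
    ∑ X ∈ univ.filter (fun X : Fin (2 * m') → GridLeg (GridPoint L N) => X j = w),
        ‖kernel ℂ (hubbardGridInteraction L N β U) (2 * m') X‖ *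
          diamWeight (fun s => (1 + lam * s) ^ k) (gridLabelDist L N β') ((univ.image X).image gridLegPos) ≤
      (if m' = 1 then |β| / N * (0 : TrigPolyC4v).coeffNorm 0 else if m' = 2 then |U| * |β| / N else 0 : ℝ) := by
  by_cases h1 : m' = 1
  · subst h1
    simp only [if_true]
    refine le_of_eq_of_le (sum_eq_zero fun X _ => ?_) (by simp [TrigPolyC4v.coeffNorm])
    rw [kernel_hubbardGridInteraction_of_ne β U (by norm_num) X, norm_zero, zero_mul]
  by_cases h2 : m' = 2
  · subst h2
    have hk : ∀ X : Fin (2 * 2) → GridLeg (GridPoint L N),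
        kernel ℂ (hubbardGridInteraction L N β U) (2 * 2) X = kernel ℂ (hubbardGridInteraction L N β U) 4 X := fun X => rfl
    simp only [if_true, show (2 : ℕ) ≠ 1 by norm_num, if_false, hk]
    refine le_trans (sum_le_sum fun X _ => ?_) (sum_norm_kernel_hubbardGridInteraction_le β U j w)
    by_cases hX : kernel ℂ (hubbardGridInteraction L N β U) 4 X = 0
    · rw [hX, norm_zero, zero_mul]
    · rw [scaledPolyWt_image_eq_one_of_kernel_hubbardGridInteraction_ne_zero β U β' lam k X hX, mul_one]
  · rw [if_neg h1, if_neg h2]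
    refine le_of_eq (sum_eq_zero fun X _ => ?_)
    rw [kernel_hubbardGridInteraction_of_ne β U (by omega) X, norm_zero, zero_mul]

/-! ## §2 The tail from order 3, any Gram-bounded covariance, any tree weight -/

omit [NeZero N] in
/-- **THE ORDER-≥3 TAIL OF THE TWO-LEG KERNEL, weighted, one leg pinned** (BGM's truncated cumulant expansion at `n₀ = 3`): for a Gram-bounded
covariance `C` (constant `κ`), the bare grid vertex `V = V_N` with its `wt`-weighted pinned profile `Nw`, `wt`-pair-weighted row/column sums `≤ α_w`,
output weight `ρ`, `θ = eα_w‖V‖_{h,wt}/κ² < 1`, and a pair weight `ω ≤ c·wt` (`c ≥ 0`), for every pinned leg `w`: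
`Σ_{Y : Y 0 = w} ω(Y)·‖kernel₂ (effAction C V − e^{Δ_C}V + ½(e^{Δ_C}(V²) − (e^{Δ_C}V)²)) (Y)‖ ≤ c·(ρ⁻²·e‖V‖_{h,wt}·θ²/(1−θ))`. -/
theorem twoLeg_wsum_tail3_le (C : Matrix (GridLeg (GridPoint L N)) (GridLeg (GridPoint L N)) ℂ) (β U : ℝ)
    {wt : Finset (GridLeg (GridPoint L N)) → ℝ} (hwt : IsTreeWeight wt) {κ : ℝ} (hκ : 0 < κ) (hGB : IsGramBoundedR C κ)
    (Nw : ℕ → ℝ) (hNw0 : ∀ m', 0 ≤ Nw m')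
    (hNw : ∀ m' (j : Fin (2 * m')) (w : GridLeg (GridPoint L N)),
      ∑ Y ∈ univ.filter (fun Y : Fin (2 * m') → GridLeg (GridPoint L N) => Y j = w),
        ‖kernel ℂ (hubbardGridInteraction L N β U) (2 * m') Y‖ * wt (univ.image Y) ≤ Nw m')
    {αw : ℝ} (hαw : 0 < αw) (hrow : ∀ X, ∑ Y, ‖C X Y‖ * wt {X, Y} ≤ αw) (hcol : ∀ Y, ∑ X, ‖C X Y‖ * wt {X, Y} ≤ αw)
    {ρ : ℝ} (hρ : 0 < ρ) (hθ : Real.exp 1 * αw * normV (GridLeg (GridPoint L N)) κ ρ Nw / κ ^ 2 < 1)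
    (ω : (Fin 2 → GridLeg (GridPoint L N)) → ℝ) {c : ℝ} (hc : 0 ≤ c) (hωle : ∀ Y, ω Y ≤ c * wt (univ.image Y))
    (w : GridLeg (GridPoint L N)) :
    ∑ Y ∈ univ.filter (fun Y : Fin 2 → GridLeg (GridPoint L N) => Y 0 = w),
        ω Y * ‖kernel ℂ (effAction ℂ C (hubbardGridInteraction L N β U) - gaussConv ℂ C (hubbardGridInteraction L N β U) +
          (2 : ℂ)⁻¹ • (gaussConv ℂ C (hubbardGridInteraction L N β U * hubbardGridInteraction L N β U) -
            gaussConv ℂ C (hubbardGridInteraction L N β U) * gaussConv ℂ C (hubbardGridInteraction L N β U))) 2 Y‖ ≤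
      c * (ρ⁻¹ ^ 2 * (Real.exp 1 * normV (GridLeg (GridPoint L N)) κ ρ Nw) *
        (Real.exp 1 * αw * normV (GridLeg (GridPoint L N)) κ ρ Nw / κ ^ 2) ^ 2 /
          (1 - Real.exp 1 * αw * normV (GridLeg (GridPoint L N)) κ ρ Nw / κ ^ 2)) := by
  set V := hubbardGridInteraction L N β U with hV
  obtain ⟨-, htr⟩ := sum_wt_norm_kernel_effAction_sub_secondOrder_le_of_gramBounded C hwt hκ hGB V
    (hubbardGridInteraction_mem_evenPart β U) (constPart_hubbardGridInteraction β U) Nw hNw0 hNw hαw hrow hcol hρ hθ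
  have h2 := htr (m := 2) two_pos 0 w
  set T := effAction ℂ C V - gaussConv ℂ C V + (2 : ℂ)⁻¹ • (gaussConv ℂ C (V * V) - gaussConv ℂ C V * gaussConv ℂ C V) with hT
  calc ∑ Y ∈ univ.filter (fun Y : Fin 2 → GridLeg (GridPoint L N) => Y 0 = w), ω Y * ‖kernel ℂ T 2 Y‖
      ≤ ∑ Y ∈ univ.filter (fun Y : Fin 2 → GridLeg (GridPoint L N) => Y 0 = w), c * (wt (univ.image Y) * ‖kernel ℂ T 2 Y‖) :=
        sum_le_sum fun Y _ => by
          rw [← mul_assoc]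
          exact mul_le_mul_of_nonneg_right (hωle Y) (norm_nonneg _)
    _ = c * ∑ Y ∈ univ.filter (fun Y : Fin 2 → GridLeg (GridPoint L N) => Y 0 = w), wt (univ.image Y) * ‖kernel ℂ T 2 Y‖ := by
        rw [mul_sum]
    _ ≤ _ := mul_le_mul_of_nonneg_left h2 hc

/-! ## §3 The grid-point form: off-site `k`-th spatial moments of the tail -/

/-- **THE OFF-SITE `k`-TH SPATIAL MOMENT OF THE TAIL** (any `k`, any Gram-bounded `C`, scaled weight `wt = (1+λ·diam)ᵏ`, `0 < λ ≤ 1`):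
with the `wt`-weighted covariance sizes `α_w`, profile `Nw` and `θ = eα_w‖V‖_{h,wt}/κ² < 1`,
`Σ_{p₁}[x⃗₁ ≠ x⃗₀](1+|Δx̃₀|+|Δx̃₁|)ᵏ·‖kernel₂ T₃ ((p₀,σ,+),(p₁,σ,−))‖ ≤ (2/λ)ᵏ·ρ⁻²·e‖V‖_{h,wt}·θ²/(1−θ)`. -/
theorem twoLeg_offDiag_moment_pow_sum_tail3_le (C : Matrix (GridLeg (GridPoint L N)) (GridLeg (GridPoint L N)) ℂ) (β U : ℝ)
    (k : ℕ) {β' : ℝ} (hβ' : 0 ≤ β') {lam : ℝ} (hlam0 : 0 < lam) (hlam1 : lam ≤ 1) {κ : ℝ} (hκ : 0 < κ) (hGB : IsGramBoundedR C κ)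
    (Nw : ℕ → ℝ) (hNw0 : ∀ m', 0 ≤ Nw m')
    (hNw : ∀ m' (j : Fin (2 * m')) (w : GridLeg (GridPoint L N)),
      ∑ Y ∈ univ.filter (fun Y : Fin (2 * m') → GridLeg (GridPoint L N) => Y j = w),
        ‖kernel ℂ (hubbardGridInteraction L N β U) (2 * m') Y‖ *
          diamWeight (fun s => (1 + lam * s) ^ k) (gridLabelDist L N β') ((univ.image Y).image gridLegPos) ≤ Nw m')
    {αw : ℝ} (hαw : 0 < αw)
    (hrow : ∀ X, ∑ Y, ‖C X Y‖ * diamWeight (fun s => (1 + lam * s) ^ k) (gridLabelDist L N β') {gridLegPos X, gridLegPos Y} ≤ αw)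
    (hcol : ∀ Y, ∑ X, ‖C X Y‖ * diamWeight (fun s => (1 + lam * s) ^ k) (gridLabelDist L N β') {gridLegPos X, gridLegPos Y} ≤ αw)
    {ρ : ℝ} (hρ : 0 < ρ) (hθ : Real.exp 1 * αw * normV (GridLeg (GridPoint L N)) κ ρ Nw / κ ^ 2 < 1)
    (σ : Fin 2) (p₀ : GridPoint L N) :
    ∑ p₁ : GridPoint L N, (if p₁.2 - p₀.2 = 0 then (0 : ℝ) else
        (1 + (((p₁.2 - p₀.2) 0).valMinAbs.natAbs : ℝ) + (((p₁.2 - p₀.2) 1).valMinAbs.natAbs : ℝ)) ^ k) *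
      ‖kernel ℂ (effAction ℂ C (hubbardGridInteraction L N β U) - gaussConv ℂ C (hubbardGridInteraction L N β U) +
          (2 : ℂ)⁻¹ • (gaussConv ℂ C (hubbardGridInteraction L N β U * hubbardGridInteraction L N β U) -
            gaussConv ℂ C (hubbardGridInteraction L N β U) * gaussConv ℂ C (hubbardGridInteraction L N β U)))
        2 (fun i => ((![p₀, p₁] i, σ), i))‖ ≤
      (2 / lam) ^ k * (ρ⁻¹ ^ 2 * (Real.exp 1 * normV (GridLeg (GridPoint L N)) κ ρ Nw) *
        (Real.exp 1 * αw * normV (GridLeg (GridPoint L N)) κ ρ Nw / κ ^ 2) ^ 2 /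
          (1 - Real.exp 1 * αw * normV (GridLeg (GridPoint L N)) κ ρ Nw / κ ^ 2)) := by
  set T := effAction ℂ C (hubbardGridInteraction L N β U) - gaussConv ℂ C (hubbardGridInteraction L N β U) +
      (2 : ℂ)⁻¹ • (gaussConv ℂ C (hubbardGridInteraction L N β U * hubbardGridInteraction L N β U) -
        gaussConv ℂ C (hubbardGridInteraction L N β U) * gaussConv ℂ C (hubbardGridInteraction L N β U)) with hT
  set ω : (Fin 2 → GridLeg (GridPoint L N)) → ℝ := fun Y => if (Y 1).1.1.2 - (Y 0).1.1.2 = 0 then (0 : ℝ) else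
      (1 + ((((Y 1).1.1.2 - (Y 0).1.1.2) 0).valMinAbs.natAbs : ℝ) + ((((Y 1).1.1.2 - (Y 0).1.1.2) 1).valMinAbs.natAbs : ℝ)) ^ k with hω
  have hω0 : ∀ Y, 0 ≤ ω Y := fun Y => by rw [hω]; dsimp only; split_ifs <;> positivity
  have hpair : ∀ X Y : GridLeg (GridPoint L N), ({X, Y} : Finset (GridLeg (GridPoint L N))).image gridLegPos = {gridLegPos X, gridLegPos Y} :=
    fun X Y => by rw [image_insert, image_singleton]
  have h := twoLeg_wsum_tail3_le C β U (isTreeWeight_scaledPolyWt (L := L) (N := N) hβ' hlam0.le k) hκ hGB Nw hNw0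
    (fun m' j w => by simpa only [Finset.image_image] using hNw m' j w) hαw (fun X => by simpa only [hpair] using hrow X)
    (fun Y => by simpa only [hpair] using hcol Y) hρ hθ ω (by positivity : (0 : ℝ) ≤ (2 / lam) ^ k)
    (fun Y => by simpa only [hω, Finset.image_image] using offDiagMomentWeight_pow_le_scaledPolyWt (L := L) (N := N) hβ' hlam0 hlam1 k Y)
    (((p₀, σ), 0))
  refine le_trans ?_ h
  refine le_trans (le_of_eq ?_) (sum_point_string_le_sum_pinned (fun Y => ω Y * ‖kernel ℂ T 2 Y‖)
      (fun Y => mul_nonneg (hω0 Y) (norm_nonneg _)) σ p₀)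
  refine sum_congr rfl fun p₁ _ => ?_
  simp only [hω, Matrix.cons_val_zero, Matrix.cons_val_one, Matrix.cons_val_fin_one]

/-! ## §4 The closed form at the bare frame: `κ₀ = ρ = √46`, `N = 4M` -/

section BareFrame

variable {M : ℕ} [NeZero M]

/-- **`θ` at the bare frame in closed form, any `κ > 0`**: with `κ = ρ`, `α = a·N/β` (`β > 0`): `e·α·normV(P₀)/κ² = 16·e⁹·κ²·a·|U|`. -/
theorem theta_frameZero_eq_gen {β : ℝ} (hβ : 0 < β) {κ : ℝ} (hκ : 0 < κ) (U a : ℝ) :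
    Real.exp 1 * (a * ((2 * (2 * M) : ℕ) : ℝ) / β) *
        normV (GridLeg (GridPoint L (2 * (2 * M)))) κ κ
          (fun m' => if m' = 1 then |β| / ((2 * (2 * M) : ℕ) : ℝ) * (0 : TrigPolyC4v).coeffNorm 0
            else if m' = 2 then |U| * |β| / ((2 * (2 * M) : ℕ) : ℝ) else 0) / κ ^ 2 =
      16 * Real.exp 1 ^ 9 * κ ^ 2 * a * |U| := by
  have hN : (0 : ℝ) < ((2 * (2 * M) : ℕ) : ℝ) := by have := NeZero.ne M; positivity
  rw [normV_frameZero_eq (L := L), abs_of_pos hβ]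
  have he2 : Real.exp 2 = Real.exp 1 ^ 2 := by rw [← Real.exp_nat_mul]; norm_num
  rw [he2]; field_simp; ring

/-- **THE OFF-SITE `k`-TH MOMENT OF THE ORDER-≥3 TAIL AT THE BARE FRAME, CLOSED FORM** (every `k`, slope `0 < λ ≤ 1`): for `μ ∈ klWindowC`,
`0 < U`, `klBetaMin ≤ β`, `klEngL₃ β U ≤ L`, every `M ≥ 1`, with `a > 0` the NORMALISED `(1+λ·diam)ᵏ`-weighted row/column size of the bare scale-`0`
grid covariance (`Σ_Y ‖C X Y‖·(1+λ·d(X,Y))ᵏ ≤ a·4M/β`, `d = gridLabelDist` at `β′ = β`) and the smallness `16·e⁹·46·a·|U| ≤ 1/2` (`= θ ≤ 1/2` at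
`κ₀ = ρ = √46`, `…ScaleZeroDetBoundFreeBand.isGramBoundedR_scaleZero_free_klEngL₃`):
`Σ_{p₁}[x⃗₁ ≠ x⃗₀](1+|Δx̃₀|+|Δx̃₁|)ᵏ·‖kernel₂ (W₀ − e^{Δ}V + ½(e^{Δ}V² − (e^{Δ}V)²)) ((p₀,σ,+),(p₁,σ,−))‖ ≤ (2/λ)ᵏ·2¹³·e²⁷·46³·a²·|U|³·β/(4M)`. -/
theorem twoLeg_offDiag_moment_pow_sum_tail3_frameZero_le {μ : ℝ} (hμ : μ ∈ klWindowC) {U : ℝ} (hU : 0 < U) {β : ℝ}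
    (hβ : klBetaMin ≤ β) (hL : klEngL₃ β U ≤ L) (k : ℕ) {lam : ℝ} (hlam0 : 0 < lam) (hlam1 : lam ≤ 1) {a : ℝ} (ha : 0 < a)
    (hrow : ∀ X, ∑ Y, ‖((hubbardGridSub L M β (2 * (2 * M))).transpose * hubbardCovAboveCT L M β μ 0 0 klE0 *
        hubbardGridSub L M β (2 * (2 * M))) X Y‖ *
        diamWeight (fun s => (1 + lam * s) ^ k) (gridLabelDist L (2 * (2 * M)) β) {gridLegPos X, gridLegPos Y} ≤
          a * ((2 * (2 * M) : ℕ) : ℝ) / β)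
    (hcol : ∀ Y, ∑ X, ‖((hubbardGridSub L M β (2 * (2 * M))).transpose * hubbardCovAboveCT L M β μ 0 0 klE0 *
        hubbardGridSub L M β (2 * (2 * M))) X Y‖ *
        diamWeight (fun s => (1 + lam * s) ^ k) (gridLabelDist L (2 * (2 * M)) β) {gridLegPos X, gridLegPos Y} ≤
          a * ((2 * (2 * M) : ℕ) : ℝ) / β)
    (hsmall : 16 * Real.exp 1 ^ 9 * 46 * a * |U| ≤ 1 / 2)
    (σ : Fin 2) (p₀ : GridPoint L (2 * (2 * M))) :
    ∑ p₁ : GridPoint L (2 * (2 * M)), (if p₁.2 - p₀.2 = 0 then (0 : ℝ) else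
        (1 + (((p₁.2 - p₀.2) 0).valMinAbs.natAbs : ℝ) + (((p₁.2 - p₀.2) 1).valMinAbs.natAbs : ℝ)) ^ k) *
      ‖kernel ℂ (effAction ℂ ((hubbardGridSub L M β (2 * (2 * M))).transpose * hubbardCovAboveCT L M β μ 0 0 klE0 *
              hubbardGridSub L M β (2 * (2 * M))) (hubbardGridInteraction L (2 * (2 * M)) β U) -
          gaussConv ℂ ((hubbardGridSub L M β (2 * (2 * M))).transpose * hubbardCovAboveCT L M β μ 0 0 klE0 *
              hubbardGridSub L M β (2 * (2 * M))) (hubbardGridInteraction L (2 * (2 * M)) β U) +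
          (2 : ℂ)⁻¹ • (gaussConv ℂ ((hubbardGridSub L M β (2 * (2 * M))).transpose * hubbardCovAboveCT L M β μ 0 0 klE0 *
                hubbardGridSub L M β (2 * (2 * M)))
              (hubbardGridInteraction L (2 * (2 * M)) β U * hubbardGridInteraction L (2 * (2 * M)) β U) -
            gaussConv ℂ ((hubbardGridSub L M β (2 * (2 * M))).transpose * hubbardCovAboveCT L M β μ 0 0 klE0 *
                hubbardGridSub L M β (2 * (2 * M))) (hubbardGridInteraction L (2 * (2 * M)) β U) *
            gaussConv ℂ ((hubbardGridSub L M β (2 * (2 * M))).transpose * hubbardCovAboveCT L M β μ 0 0 klE0 *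
                hubbardGridSub L M β (2 * (2 * M))) (hubbardGridInteraction L (2 * (2 * M)) β U)))
        2 (fun i => ((![p₀, p₁] i, σ), i))‖ ≤
      (2 / lam) ^ k * ((2 : ℝ) ^ 13 * Real.exp 1 ^ 27 * (46 : ℝ) ^ 3 * a ^ 2 * |U| ^ 3 * (β / ((2 * (2 * M) : ℕ) : ℝ))) := by
  haveI : NeZero (2 * (2 * M)) := ⟨by have := NeZero.ne M; omega⟩
  have hβ0 : 0 < β := lt_of_lt_of_le (by norm_num [klBetaMin]) hβ
  have hN : (0 : ℝ) < ((2 * (2 * M) : ℕ) : ℝ) := by have := NeZero.ne M; positivity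
  have h46 : (2 * (7 + 16) : ℝ) = 46 := by norm_num
  have hκ : (0 : ℝ) < Real.sqrt (2 * (7 + 16)) := Real.sqrt_pos.2 (by norm_num)
  have hκsq : Real.sqrt (2 * (7 + 16)) ^ 2 = 46 := by rw [Real.sq_sqrt (by norm_num), h46]
  have hGB := isGramBoundedR_scaleZero_free_klEngL₃ (L := L) (M := M) hμ hβ hL
  have hα : 0 < a * ((2 * (2 * M) : ℕ) : ℝ) / β := by positivity
  have hθeq' := theta_frameZero_eq_gen (L := L) (M := M) hβ0 hκ U a
  have hθeq : Real.exp 1 * (a * ((2 * (2 * M) : ℕ) : ℝ) / β) *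
      normV (GridLeg (GridPoint L (2 * (2 * M)))) (Real.sqrt (2 * (7 + 16))) (Real.sqrt (2 * (7 + 16)))
        (fun m' => if m' = 1 then |β| / ((2 * (2 * M) : ℕ) : ℝ) * (0 : TrigPolyC4v).coeffNorm 0
          else if m' = 2 then |U| * |β| / ((2 * (2 * M) : ℕ) : ℝ) else 0) / Real.sqrt (2 * (7 + 16)) ^ 2 =
      16 * Real.exp 1 ^ 9 * 46 * a * |U| := by rw [hθeq', hκsq]
  have hθ0 : 0 ≤ 16 * Real.exp 1 ^ 9 * 46 * a * |U| := by positivity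
  have hθlt : Real.exp 1 * (a * ((2 * (2 * M) : ℕ) : ℝ) / β) *
      normV (GridLeg (GridPoint L (2 * (2 * M)))) (Real.sqrt (2 * (7 + 16))) (Real.sqrt (2 * (7 + 16)))
        (fun m' => if m' = 1 then |β| / ((2 * (2 * M) : ℕ) : ℝ) * (0 : TrigPolyC4v).coeffNorm 0
          else if m' = 2 then |U| * |β| / ((2 * (2 * M) : ℕ) : ℝ) else 0) / Real.sqrt (2 * (7 + 16)) ^ 2 < 1 := by
    rw [hθeq]; exact hsmall.trans_lt (by norm_num)
  have hP0 : ∀ m', 0 ≤ (if m' = 1 then |β| / ((2 * (2 * M) : ℕ) : ℝ) * (0 : TrigPolyC4v).coeffNorm 0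
      else if m' = 2 then |U| * |β| / ((2 * (2 * M) : ℕ) : ℝ) else 0 : ℝ) := fun m' => by
    have := TrigPolyC4v.coeffNorm_nonneg 0 (0 : TrigPolyC4v); split_ifs <;> positivity
  have h := twoLeg_offDiag_moment_pow_sum_tail3_le _ β U k hβ0.le hlam0 hlam1 hκ hGB _ hP0
    (sum_norm_kernel_hubbardGridInteraction_mul_scaledPolyWt_le β U lam k) hα hrow hcol hκ hθlt σ p₀
  refine h.trans ?_
  refine mul_le_mul_of_nonneg_left ?_ (by positivity)
  rw [hθeq]
  have hnV := normV_frameZero_eq (L := L) (M := M) (Real.sqrt (2 * (7 + 16))) (Real.sqrt (2 * (7 + 16))) β U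
  rw [hnV]
  have he2 : Real.exp 2 = Real.exp 1 ^ 2 := by rw [← Real.exp_nat_mul]; norm_num
  have hθle : 16 * Real.exp 1 ^ 9 * 46 * a * |U| ≤ 1 / 2 := hsmall
  -- `X·θ²/(1−θ) ≤ 2·X·θ²` for `θ ≤ 1/2`
  have hX : 0 ≤ (Real.sqrt (2 * (7 + 16)))⁻¹ ^ 2 *
      (Real.exp 1 * ((Real.exp 2 * (Real.sqrt (2 * (7 + 16)) + Real.sqrt (2 * (7 + 16)))) ^ 4 *
        (|U| * |β| / ((2 * (2 * M) : ℕ) : ℝ)))) := by positivity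
  have hfrac : (Real.sqrt (2 * (7 + 16)))⁻¹ ^ 2 *
      (Real.exp 1 * ((Real.exp 2 * (Real.sqrt (2 * (7 + 16)) + Real.sqrt (2 * (7 + 16)))) ^ 4 *
        (|U| * |β| / ((2 * (2 * M) : ℕ) : ℝ)))) * (16 * Real.exp 1 ^ 9 * 46 * a * |U|) ^ 2 /
        (1 - 16 * Real.exp 1 ^ 9 * 46 * a * |U|) ≤
      2 * ((Real.sqrt (2 * (7 + 16)))⁻¹ ^ 2 *
      (Real.exp 1 * ((Real.exp 2 * (Real.sqrt (2 * (7 + 16)) + Real.sqrt (2 * (7 + 16)))) ^ 4 *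
        (|U| * |β| / ((2 * (2 * M) : ℕ) : ℝ))))) * (16 * Real.exp 1 ^ 9 * 46 * a * |U|) ^ 2 := by
    rw [div_le_iff₀ (by linarith)]
    have hsq : 0 ≤ (16 * Real.exp 1 ^ 9 * 46 * a * |U|) ^ 2 := sq_nonneg _
    nlinarith [mul_nonneg hX hsq]
  refine hfrac.trans (le_of_eq ?_)
  -- algebra: `√46⁻²·e·(2e²√46)⁴·|U|β/N · 2 · (16e⁹·46·a|U|)² = 2¹³e²⁷46³a²|U|³β/N` (`field_simp` consumes `hκsq` from the context)
  rw [abs_of_pos hβ0, abs_of_pos hU, he2]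
  field_simp
  norm_num

end BareFrame

end Summit.HubbardSuperconductivity.HubbardSuperconductivity.Theorems.EngineV8

end
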